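import Literature.ModelTheory.FiniteModelTheory.SymmetricCircuitCountingWidthProofs

/-!
# The coset game: a fooling criterion for symmetric circuits with GROUP supports

Technology for the `WindowBarrier` / `NoHiddenOrder` dichotomy of route `PneNP/SymmetryBudget`
(items stmt-PneNP-2145 / stmt-PneNP-14781), exponential regime.  The Anderson–Dawar support argument
(`Literature.ModelTheory.FiniteModelTheory.eval_adjInput_eq_of_ckEquiv`: gates supported by `≤ k`
POINTS are fooled by `≡^{C^{2k+2}}`-equivalent graphs) stops at orbit size `2^{o(n)}`
(Dawar–Wilsenach 2025, Thm. 6.4).  In the window (`Sym(n)`-symmetric circuits of size `2^{O(n)}`)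
gates are no longer stabilised by the pointwise stabiliser of a small set, but — by the entropy
support theorem `Summit.PneNP.PneNP.Theorems.entropySupportTheorem` — by a product of alternating
groups of a bounded-entropy partition.  This file proves the matching invariance principle for
ARBITRARY stabilising subgroups, in the weakest form the induction needs:

* **`CosetGame.wireValue_eq_of_game`.**  Let `C` be a circuit on `n × n` adjacency inputs with
  symmetric gate functions, and for every gate `j` let `A j ≤ Sym(Fin n)` be a subgroup each of whose
  elements extends to an automorphism of `C` fixing `j`.  Let `R w β β'` be a relation between
  relabellings `β` (for `G`) and `β'` (for `H`) at every wire `w`, such that (i) at an input wire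
  `x_{pq}` related relabellings read equal adjacency bits, and (ii) at a gate `j`, for every argument
  wire `w` of `j`, related `(β, β')` admit a bijection `e : A j ≃ A j` with `(β ρ, β' (e ρ))` related at
  `w` for all `ρ ∈ A j`.  Then related relabellings give gate `j` the same value on `G` and on `H`.
  Proof: Anderson–Dawar's averaging identity `|A j| · #{true children at β} = Σ_i #{ρ ∈ A j : child i
  true at β ρ}` (automorphisms fixing `j` permute its children and transport values), and the
  bijection `e` reindexes the `H`-side count — no pebbles, no supports.
* **`CosetGame.eval_eq_of_game`.**  For a `Sym(Fin n)`-symmetric circuit over `tcBasis`, if moreover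
  some pair of relabellings is related at the output gate, then `C` accepts the adjacency matrix of `G`
  iff it accepts that of `H` (symmetry moves the evaluation to any relabelling).

Positions of the induced game are left cosets `β · A j` ("oriented ordered partitions" when
`A j = ∏ Alt(block)`); Duplicator's bijections act on cosets, not on vertices — the vertex-bijection
game would be won by Spoiler in three rounds, the coset game is exactly as strong as the circuits
(this file: soundness).  The entropy-bounded specialisation with the window's support theorem is
`SymmetryBudgetWindowBarrierEntropyGame.lean`.
-/

-- `Summit.PneNP.PneNP.…` duplicates `PneNP` BY DESIGN (single-problem summit).
set_option linter.dupNamespace false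

namespace Summit.PneNP.PneNP.Theorems

open Finset Literature.Computability.Complexity Literature.ModelTheory.FiniteModelTheory

namespace CosetGame

variable {n : ℕ}

/-- **Automorphisms fixing a gate preserve its number of true children** (Anderson–Dawar, Claim
27(ii), for an arbitrary stabilising element): if `σ` is an automorphism of `C` over `ρ × ρ` fixing
gate `j`, the number of argument wires of `j` true at `β` equals the number true at `β * ρ`. -/
theorem numOnes_wireValue_eq_of_fix (C : Circuit (Fin n × Fin n)) (G : SimpleGraph (Fin n))
    [DecidableRel G.Adj] (hsym : ∀ g ∈ C.gates, g.fn.IsSymmetric) {j : ℕ} (hj : j < C.gates.length)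
    (β ρ : Equiv.Perm (Fin n)) {σ : Equiv.Perm (Fin C.gates.length)}
    (hσ : C.IsInducedAut (fun q : Fin n × Fin n => (ρ q.1, ρ q.2)) σ) (hσj : σ ⟨j, hj⟩ = ⟨j, hj⟩) :
    GateFn.numOnes (fun i => wireValue C G β ((C.gates[j]).args i)) =
      GateFn.numOnes (fun i => wireValue C G (β * ρ) ((C.gates[j]).args i)) := by
  have hidx : C.gates[σ ⟨j, hj⟩] = C.gates[j] := by
    have h := congrArg (fun i : Fin C.gates.length => C.gates[i]) hσj
    simpa using h
  have h2 := (hσ.2 ⟨j, hj⟩).2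
  rw [hidx] at h2
  simp only [Fin.getElem_fin] at h2
  exact Circuit.numOnes_eq_of_perm_map h2 fun i => wireValue_relabelWire G hsym hσ β _

/-- **Averaging over a stabilising subgroup** (Anderson–Dawar, Claim 28, first line, with the
pointwise stabiliser of a support replaced by any subgroup `A` of gate-fixing permutations):
`|A| · #{true children of j at β} = Σ_i #{ρ ∈ A : child i true at β ρ}`. -/
theorem card_mul_numOnes (C : Circuit (Fin n × Fin n)) (G : SimpleGraph (Fin n)) [DecidableRel G.Adj]
    (hsym : ∀ g ∈ C.gates, g.fn.IsSymmetric) {j : ℕ} (hj : j < C.gates.length)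
    (A : Subgroup (Equiv.Perm (Fin n))) [Fintype A]
    (hA : ∀ ρ ∈ A, ∃ σ : Equiv.Perm (Fin C.gates.length),
      C.IsInducedAut (fun q : Fin n × Fin n => (ρ q.1, ρ q.2)) σ ∧ σ ⟨j, hj⟩ = ⟨j, hj⟩)
    (β : Equiv.Perm (Fin n)) :
    Fintype.card A * GateFn.numOnes (fun i => wireValue C G β ((C.gates[j]).args i)) =
      ∑ i : Fin (C.gates[j]).arity, ∑ ρ : A,
        (if wireValue C G (β * ρ) ((C.gates[j]).args i) = true then 1 else 0) := by
  calc Fintype.card A * GateFn.numOnes (fun i => wireValue C G β ((C.gates[j]).args i))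
      = ∑ _ρ : A, GateFn.numOnes (fun i => wireValue C G β ((C.gates[j]).args i)) := by
        rw [Finset.sum_const, Finset.card_univ, smul_eq_mul]
    _ = ∑ ρ : A, GateFn.numOnes (fun i => wireValue C G (β * ρ) ((C.gates[j]).args i)) := by
        refine Finset.sum_congr rfl fun ρ _ => ?_
        obtain ⟨σ, hσ, hσj⟩ := hA ρ ρ.2
        exact numOnes_wireValue_eq_of_fix C G hsym hj β ρ hσ hσj
    _ = ∑ ρ : A, ∑ i : Fin (C.gates[j]).arity,
          (if wireValue C G (β * ρ) ((C.gates[j]).args i) = true then 1 else 0) := by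
        simp only [GateFn.numOnes, Finset.card_filter]
    _ = _ := Finset.sum_comm

/-- **The coset game fools the circuit** (soundness of the coset game, gate by gate).  `A j` is a
subgroup of permutations extending to automorphisms fixing gate `j`; `R w β β'` relates relabellings
of `G` and of `H` at wire `w`; (i) at input wires related relabellings read equal bits; (ii) at gate
`j`, for each argument wire `w`, related `(β, β')` admit a bijection `e` of `A j` with
`(β ρ, β' (e ρ))` related at `w`.  Then at every gate related relabellings give equal values. -/
theorem wireValue_eq_of_game {C : Circuit (Fin n × Fin n)} {G H : SimpleGraph (Fin n)}
    [DecidableRel G.Adj] [DecidableRel H.Adj] (hsym : ∀ g ∈ C.gates, g.fn.IsSymmetric)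
    (A : ℕ → Subgroup (Equiv.Perm (Fin n)))
    (hA : ∀ (j : ℕ) (hj : j < C.gates.length), ∀ ρ ∈ A j, ∃ σ : Equiv.Perm (Fin C.gates.length),
      C.IsInducedAut (fun q : Fin n × Fin n => (ρ q.1, ρ q.2)) σ ∧ σ ⟨j, hj⟩ = ⟨j, hj⟩)
    (R : (Fin n × Fin n) ⊕ ℕ → Equiv.Perm (Fin n) → Equiv.Perm (Fin n) → Prop)
    (hRin : ∀ (q : Fin n × Fin n) (β β' : Equiv.Perm (Fin n)), R (Sum.inl q) β β' →
      (G.Adj (β q.1) (β q.2) ↔ H.Adj (β' q.1) (β' q.2)))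
    (hRstep : ∀ (j : ℕ) (hj : j < C.gates.length) (i : Fin (C.gates[j]).arity)
      (β β' : Equiv.Perm (Fin n)), R (Sum.inr j) β β' →
        ∃ e : A j ≃ A j, ∀ ρ : A j, R ((C.gates[j]).args i) (β * ρ) (β' * e ρ)) :
    ∀ (j : ℕ) (hj : j < C.gates.length) (β β' : Equiv.Perm (Fin n)), R (Sum.inr j) β β' →
      wireValue C G β (Sum.inr j) = wireValue C H β' (Sum.inr j) := by
  intro j
  induction j using Nat.strong_induction_on with
  | _ j ih =>
  intro hj β β' hR
  classical
  rw [wireValue_inr_of_lt C G β hj, wireValue_inr_of_lt C H β' hj]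
  refine Gate.op_eq_op_of_fn_eq rfl (hsym (C.gates[j]) (List.getElem_mem hj)) ?_
  -- the induction hypothesis in wire form, for the argument wires of gate `j`
  have hwire : ∀ (i : Fin (C.gates[j]).arity) (γ γ' : Equiv.Perm (Fin n)),
      R ((C.gates[j]).args i) γ γ' →
      wireValue C G γ ((C.gates[j]).args i) = wireValue C H γ' ((C.gates[j]).args i) := by
    intro i γ γ' hR'
    generalize hw : (C.gates[j]).args i = w at hR' ⊢
    cases w with
    | inl q =>
      rw [wireValue_inl, wireValue_inl]
      exact (decide_eq_decide).2 (hRin q γ γ' hR')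
    | inr m =>
      have hm : m < j := C.wf j hj i m hw
      exact ih m hm (hm.trans hj) γ γ' hR'
  -- per-argument counts agree, by the bijection of the game and the hypothesis `hwire`
  have hcount : ∀ i : Fin (C.gates[j]).arity,
      (∑ ρ : A j, (if wireValue C G (β * ρ) ((C.gates[j]).args i) = true then 1 else 0 : ℕ)) =
      ∑ ρ : A j, (if wireValue C H (β' * ρ) ((C.gates[j]).args i) = true then 1 else 0 : ℕ) := by
    intro i
    obtain ⟨e, he⟩ := hRstep j hj i β β' hR
    calc (∑ ρ : A j, (if wireValue C G (β * ρ) ((C.gates[j]).args i) = true then 1 else 0 : ℕ))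
        = ∑ ρ : A j, (if wireValue C H (β' * e ρ) ((C.gates[j]).args i) = true then 1 else 0 : ℕ) :=
          Finset.sum_congr rfl fun ρ _ => by rw [hwire i (β * ρ) (β' * e ρ) (he ρ)]
      _ = ∑ ρ : A j, (if wireValue C H (β' * ρ) ((C.gates[j]).args i) = true then 1 else 0 : ℕ) :=
          Fintype.sum_equiv e _ _ fun _ => rfl
  -- conclude with the averaging identity and cancellation of `|A j| > 0`
  have hsumG := card_mul_numOnes C G hsym hj (A j) (hA j hj) β
  have hsumH := card_mul_numOnes C H hsym hj (A j) (hA j hj) β'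
  have hpos : 0 < Fintype.card (A j) := Fintype.card_pos
  refine Nat.eq_of_mul_eq_mul_left hpos ?_
  rw [hsumG, hsumH]
  exact Finset.sum_congr rfl fun i _ => hcount i

/-- In a symmetric circuit with symmetric gates the value of the output wire does not depend on the
relabelling (every permutation extends to an automorphism, which fixes the output and transports
values). -/
theorem wireValue_output_eq {C : Circuit (Fin n × Fin n)} (G : SimpleGraph (Fin n))
    [DecidableRel G.Adj] (hsym : ∀ g ∈ C.gates, g.fn.IsSymmetric)
    (hsymC : C.IsSymmetricUnder Set.univ) (β : Equiv.Perm (Fin n)) :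
    wireValue C G 1 C.output = wireValue C G β C.output := by
  obtain ⟨σ, hσ⟩ := hsymC β (Set.mem_univ _)
  have key := wireValue_relabelWire G hsym hσ 1 C.output
  rw [hσ.1, one_mul] at key
  exact key

/-- **The coset game fools symmetric circuits.**  For a `Sym(Fin n)`-symmetric circuit over the
threshold basis `tcBasis` equipped with a coset game as in `wireValue_eq_of_game` whose relation is
inhabited at the output gate, the circuit accepts the adjacency matrix of `G` iff it accepts that
of `H`. -/
theorem eval_eq_of_game {C : Circuit (Fin n × Fin n)} (hB : C.IsOver tcBasis)
    (hsymC : C.IsSymmetricUnder Set.univ) {G H : SimpleGraph (Fin n)} [DecidableRel G.Adj]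
    [DecidableRel H.Adj] (A : ℕ → Subgroup (Equiv.Perm (Fin n)))
    (hA : ∀ (j : ℕ) (hj : j < C.gates.length), ∀ ρ ∈ A j, ∃ σ : Equiv.Perm (Fin C.gates.length),
      C.IsInducedAut (fun q : Fin n × Fin n => (ρ q.1, ρ q.2)) σ ∧ σ ⟨j, hj⟩ = ⟨j, hj⟩)
    (R : (Fin n × Fin n) ⊕ ℕ → Equiv.Perm (Fin n) → Equiv.Perm (Fin n) → Prop)
    (hRin : ∀ (q : Fin n × Fin n) (β β' : Equiv.Perm (Fin n)), R (Sum.inl q) β β' →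
      (G.Adj (β q.1) (β q.2) ↔ H.Adj (β' q.1) (β' q.2)))
    (hRstep : ∀ (j : ℕ) (hj : j < C.gates.length) (i : Fin (C.gates[j]).arity)
      (β β' : Equiv.Perm (Fin n)), R (Sum.inr j) β β' →
        ∃ e : A j ≃ A j, ∀ ρ : A j, R ((C.gates[j]).args i) (β * ρ) (β' * e ρ))
    (hout : ∀ j : ℕ, C.output = Sum.inr j → ∃ β β' : Equiv.Perm (Fin n), R (Sum.inr j) β β') :
    C.eval (adjInput G) = C.eval (adjInput H) := by
  have hsym : ∀ g ∈ C.gates, g.fn.IsSymmetric := fun g hg => isSymmetric_of_mem_tcBasis (hB g hg)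
  rw [eval_adjInput_eq_wireValue C G, eval_adjInput_eq_wireValue C H]
  cases hC : C.output with
  | inl q =>
    obtain ⟨p, q⟩ := q
    have hpq : p = q := by
      obtain ⟨σ, hσ⟩ := hsymC (Equiv.swap p q) (Set.mem_univ _)
      have h1 := hσ.1
      rw [hC, Circuit.relabelWire_inl, Sum.inl.injEq, Prod.mk.injEq, Equiv.swap_apply_left] at h1
      exact h1.1.symm
    subst hpq
    rw [wireValue_inl, wireValue_inl]
    simp
  | inr m =>
    have hm : m < C.gates.length := C.wf_output m hC
    obtain ⟨β, β', hR⟩ := hout m hC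
    have hG := wireValue_output_eq G hsym hsymC β
    have hH := wireValue_output_eq H hsym hsymC β'
    rw [hC] at hG hH
    rw [hG, hH]
    exact wireValue_eq_of_game hsym A hA R hRin hRstep m hm β β' hR

end CosetGame

end Summit.PneNP.PneNP.Theorems
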